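import Literature.AnabelianGeometry.EtaleTheta.ArithThetaTowerDivisorMonoids
import Literature.AnabelianGeometry.EtaleTheta.ArithThetaTowerRealifiedPrelim
import Literature.AnabelianGeometry.EtaleTheta.RealifiedDivisorMonoidsOfRlfWeak
import HarnessLib

/-!
# [EtTh] Def. 3.6 (i) / Prop. 3.4 (i) for the ARITHMETIC THETA TOWER, ENGINE FORM: `Φ₀` of GA-02's
# `ArithThetaTower.divisorMonoidsOf d T A hZ` is perf-factorial (weak, cofinal) and the realified data
# `ArithThetaTower.realifiedOf d T A hZ := ofRlfZWeak (divisorMonoidsOf d T A hZ) _` (GAP A, row D3 / item GA-03)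

Mochizuki, *The étale theta function and its Frobenioid-theoretic manifestations*, Publ. RIMS **45** (2009), §3:
Prop. 3.4 (i) PDF p. 74 ("`Φ₀(Y^log)` … is perf-factorial"), Def. 3.6 (i) p. 76 ("write `Φ₀^ℝ := Φ₀^rlf` … `B₀^Λ` for
`B₀` … if `Λ = ℤ` …, `F₀^Λ ⊆ B₀^Λ` for `F₀`"), Rmk. 3.3.1 p. 73 [cite: MochizukiEtTh2009, Def 3.6 p.76]; Mochizuki,
*Inter-universal Teichmüller theory I*, Ex. 3.2 (i)–(ii) p. 70 (the tempered Frobenioid `ℱ̲_v` at a bad place over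
`𝒟_v = 𝓑^temp(X̲̲_v)⁰`) [cite: Mochizuki2012, I Ex 3.2 (ii) p.70]; *Frobenioids II*, Ex. 1.1 (i) p. 7
[cite: MochizukiFrdII2008, Ex 1.1 (i) p.7].

abc-iut cell, GAP A (G-L5-EX32I-1; [IUTchI] Ex. 3.2 (i)(ii)(iii)), item **GA-03** (seat abc-iut-gapA-03-realified) = memo
GAP-SIZING-A (69de97346848d3e8) §2 row D3, RULED SHAPE `plan/L5/GAP-A-SIGNATURES.md` v1 e3ccddf9b87597cf §3 — here at the
ENGINE of GA-02 (RULINGS #334 (1): `divisorMonoidsOf d T (A : Z.GaloisAction P) (hZ : Z.CuspLaws) : DivisorMonoids T.Dv`,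
★ p667325 `ArithThetaTowerDivisorMonoids.lean`, with `Φ₀(U) = ord(𝒪^▷_{Ω^{aug U}}) × A.phiZero (P/U)` by `rfl`), i.e.
generically in the Galois-action record `A` on `P = Π_v̲`; the RULED declarations `isPerfFactorial_divisorMonoids d T` /
`realified d T` (file `ArithThetaTowerRealified.lean`) are these at GA-02's theta envelope
`divisorMonoids d T := divisorMonoidsOf d T (envelopeAction d T) (envelope_cuspLaws d T)`.

* `ArithThetaTower.isPerfFactorial_divisorMonoidsOf d T A hZ : ∀ Y, IsPerfFactorialCof ((divisorMonoidsOf d T A hZ).Φ₀.obj Y)`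
  — the `hpf` hypothesis of `RealifiedDivisorMonoids.ofRlfZWeak` ([EtTh] Prop. 3.4 (i) in the cell's weak vocabulary of
  record), by THIS SEAT's `isPerfFactorial_constProdGeom` (★ p668061 `ArithThetaTowerRealifiedPrelim.lean`: both factors
  have charts into `∏ ℤ≥0`, charts multiply — ★ p667541 `ArithThetaTowerPerfFactorialProducts.lean`); every prime
  component `ℤ`-monoprime (Rmk. 3.3.1);
* **`ArithThetaTower.realifiedOf d T A hZ : RealifiedDivisorMonoids (D₀ := T.Dv) treeMonoidVocabWeak.{0}`** :=
  `RealifiedDivisorMonoids.ofRlfZWeak (divisorMonoidsOf d T A hZ) (isPerfFactorial_divisorMonoidsOf d T A hZ)` — [EtTh]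
  Def. 3.6 (i) for `Λ = ℤ` over the weak vocabulary (abc-iut-L6-t12's constructor; pattern `TateTowerArithFrd` `(dm D) (hpf D)`):
  `Φ₀^ℝ := Φ₀^rlf`, `B₀^ℤ := B₀`, `F₀^ℤ := F₀`, `B₀ → (Φ₀^ℝ)^gp := ι^gp ∘ div₀`, `ℝ·Φ₀^cnst :=` the `ℝ`-span;
* the definitional unfoldings consumers (GA-04 / GA-12 `CarrierSpec.Φ_carrier` / `consts`, GA-07 knit) read:
  `realifiedOf_toDivisorMonoids / _Λ / _ΦR / _toR(_apply) / _BΛ(_obj) / _FΛ / _divΛ_apply / _cnstR / _ncspR / _cspR`.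

HONEST FRAMING: a construction over the tree's typed interfaces (`GaloisValDatum`, `BadLocalGroupDatum`,
`LogDivisorModel.GaloisAction` — interface records; nothing asserts they arise from an actual curve); "perf-factorial"
READ in the cell's weak vocabulary of record (`IsPerfFactorialCof`, F-L2d2-1/F-L2d2-2); the carrier and its (c3′) label
are GA-02's — this file adds no carrier choice; an UNDISPUTED construction step around [IUTchIII] Cor. 3.12, on which NO
side is taken (D-0045); COUNT-NEUTRAL; typed ≠ inhabited ≠ proved-in-print; nothing here asserts the abc conjecture
proved or refuted.
-/

noncomputable section

namespace Literature.AnabelianGeometry.EtaleTheta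

open CategoryTheory Opposite Literature.AlgebraicGeometry.Frobenioids Literature.AlgebraicGeometry.Frobenioids.PadicFrd
  Literature.IUT.HodgeTheaters

namespace ArithThetaTower

variable {p : ℕ} [Fact p.Prime] (d : GaloisValDatum.{0} p) {P : Type} [Group P] [TopologicalSpace P]
  (T : BadLocalGroupDatum d.Gal P) {Z : LogDivisorModel.{0}} (A : Z.GaloisAction P) (hZ : Z.CuspLaws)

/-! ### Prop. 3.4 (i) at the engine -/

/-- **[EtTh] Prop. 3.4 (i) (weak, with cofinal perfection) for every `Φ₀(U)` of GA-02's engine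
`divisorMonoidsOf d T A hZ`** — `Φ₀(U) = ord(𝒪^▷_{Ω^{aug U}}) × A.phiZero (P/U)` (`divisorMonoidsOf_Φ₀_obj`, `rfl`): the
`hpf` hypothesis of `RealifiedDivisorMonoids.ofRlfZWeak`; `isPerfFactorial_constProdGeom` ON THE NOSE (the engine IS
«constants × geometric» by definition, `divisorMonoidsOf_eq`). [cite: MochizukiEtTh2009, Prop 3.4 p.74] -/
theorem isPerfFactorial_divisorMonoidsOf :
    ∀ Y : (T.Dv)ᵒᵖ, IsPerfFactorialCof ((divisorMonoidsOf d T A hZ).Φ₀.obj Y) :=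
  isPerfFactorial_constProdGeom d T A hZ

/-- Every prime component of `Φ₀(U)` of the engine is `ℤ`-monoprime (`≅ ℤ≥0`; Rmk. 3.3.1: the one prime of
`ord(𝒪^▷_{Ω^{aug U}})` and the `P`-orbits of prime log-divisors of `Z`). [cite: MochizukiEtTh2009, Rmk 3.3.1 p.73] -/
theorem isZMonoprime_submonoid_primes_divisorMonoidsOf (Y : (T.Dv)ᵒᵖ)
    (𝔭 : Primes ((divisorMonoidsOf d T A hZ).Φ₀.obj Y)) : IsZMonoprime ↥𝔭.submonoid :=
  isZMonoprime_submonoid_primes_constProdGeom d T A hZ Y 𝔭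

/-- Prop. 3.4 (i), first clause, in the weak vocabulary of record (`treeMonoidVocabWeak.IsPerfFactorial =
IsPerfFactorialCof`), at the engine. [cite: MochizukiEtTh2009, Prop 3.4 p.74] -/
theorem prop34_i_divisorMonoidsOf (Y : (T.Dv)ᵒᵖ) :
    treeMonoidVocabWeak.IsPerfFactorial ((divisorMonoidsOf d T A hZ).Φ₀.obj Y) :=
  (treeMonoidVocabWeak_isPerfFactorial _).mpr (isPerfFactorial_divisorMonoidsOf d T A hZ Y)

/-! ### Def. 3.6 (i) at the engine -/

/-- **[EtTh] Def. 3.6 (i) for the arithmetic theta tower, ENGINE FORM** (`Λ = ℤ`, weak data): the realified divisor data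
`ofRlfZWeak (divisorMonoidsOf d T A hZ) (isPerfFactorial_divisorMonoidsOf d T A hZ)` — `Φ₀^ℝ := Φ₀^rlf` (the weak
realification functor), `B₀^ℤ := B₀ = (Ω^{aug U})ˣ × Mero(Z)^U`, `F₀^ℤ := F₀`, `B₀ → (Φ₀^ℝ)^gp := ι^gp ∘ div₀`, `ℝ·Φ₀^cnst :=`
the `ℝ`-span of `Φ₀^cnst`, (non-)cuspidal parts by support.  The carrier and its (c3′) label are GA-02's.
[cite: MochizukiEtTh2009, Def 3.6 p.76] -/
def realifiedOf : RealifiedDivisorMonoids (D₀ := T.Dv) treeMonoidVocabWeak.{0} :=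
  RealifiedDivisorMonoids.ofRlfZWeak (divisorMonoidsOf d T A hZ) (isPerfFactorial_divisorMonoidsOf d T A hZ)

/-! ### What `realifiedOf` returns (definitional unfoldings for consumers) -/

/-- `realifiedOf` keeps GA-02's Def. 3.3 (iii) data. [cite: MochizukiEtTh2009, Def 3.6 p.76] -/
@[simp] theorem realifiedOf_toDivisorMonoids :
    (realifiedOf d T A hZ).toDivisorMonoids = divisorMonoidsOf d T A hZ := rfl

/-- The monoid type of `realifiedOf` is `ℤ`. [cite: MochizukiEtTh2009, Def 3.6 p.76] -/
@[simp] theorem realifiedOf_Λ : (realifiedOf d T A hZ).Λ = MonoidType.Z := rfl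

/-- `Φ₀^ℝ` of `realifiedOf` is the weak realification functor `Φ₀^rlf` of the engine's `Φ₀`.
[cite: MochizukiEtTh2009, Def 3.6 p.76] -/
theorem realifiedOf_ΦR : (realifiedOf d T A hZ).ΦR =
    rlfFunctorWeak (divisorMonoidsOf d T A hZ).Φ₀ (isPerfFactorial_divisorMonoidsOf d T A hZ) := rfl

/-- `Φ₀ → Φ₀^ℝ` of `realifiedOf` is the natural map `Φ₀ → Φ₀^pf → Φ₀^rlf`. [cite: MochizukiEtTh2009, Def 3.6 p.76] -/
theorem realifiedOf_toR (Y : (T.Dv)ᵒᵖ) : (realifiedOf d T A hZ).toR Y =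
    ((toRlfNatTransWeak (divisorMonoidsOf d T A hZ).Φ₀ (isPerfFactorial_divisorMonoidsOf d T A hZ)).app Y).hom := rfl

/-- `Φ₀ → Φ₀^ℝ` of `realifiedOf` on elements: `a ↦` the factorization of the image of `a` in `Φ₀(U)^pf`.
[cite: MochizukiEtTh2009, Def 3.6 p.76] -/
theorem realifiedOf_toR_apply (Y : (T.Dv)ᵒᵖ) (a : (divisorMonoidsOf d T A hZ).Φ₀.obj Y) :
    (realifiedOf d T A hZ).toR Y a =
      (isPerfFactorial_divisorMonoidsOf d T A hZ Y).weak.toRealification (Perfection.of _ a) := rfl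

/-- `B₀^ℤ := B₀` (GA-02's `(Ω^{aug U})ˣ × Hom_P(P/U, Mero(Z))`). [cite: MochizukiEtTh2009, Def 3.6 p.76] -/
@[simp] theorem realifiedOf_BΛ : (realifiedOf d T A hZ).BΛ = (divisorMonoidsOf d T A hZ).B₀ := rfl

/-- `B₀^ℤ(U)` on objects: `(Ω^{aug U})ˣ × Hom_P(P/U, Mero(Z))`. [cite: MochizukiEtTh2009, Def 3.6 p.76] -/
theorem realifiedOf_BΛ_obj (U : (T.Dv)ᵒᵖ) : (realifiedOf d T A hZ).BΛ.obj U =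
    CommMonCat.of (((constFld d T U.unop).K)ˣ × A.bZero ((cosetGSetFunctor P).obj U.unop)) := rfl

/-- `F₀^ℤ := F₀` (GA-02's `(Ω^{aug U})ˣ × (constants of Z)^U`). [cite: MochizukiEtTh2009, Def 3.6 p.76] -/
@[simp] theorem realifiedOf_FΛ (Y : (T.Dv)ᵒᵖ) : (realifiedOf d T A hZ).FΛ Y = (divisorMonoidsOf d T A hZ).F₀ Y := rfl

/-- `B₀^ℤ → (Φ₀^ℝ)^gp` of `realifiedOf` is `ι^gp ∘ div₀`. [cite: MochizukiEtTh2009, Def 3.6 p.76] -/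
theorem realifiedOf_divΛ_apply (Y : (T.Dv)ᵒᵖ) (b : (divisorMonoidsOf d T A hZ).B₀.obj Y) :
    (realifiedOf d T A hZ).divΛ Y b =
      gpMap ((toRlfNatTransWeak (divisorMonoidsOf d T A hZ).Φ₀ (isPerfFactorial_divisorMonoidsOf d T A hZ)).app Y).hom
        ((divisorMonoidsOf d T A hZ).div₀ Y b) := rfl

/-- `ℝ·Φ₀^cnst` of `realifiedOf` is the `ℝ`-span of `Φ₀^cnst` in `(Φ₀^rlf)^gp` (THE weak realification data).
[cite: MochizukiEtTh2009, Def 3.6 p.76] -/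
theorem realifiedOf_cnstR (Y : (T.Dv)ᵒᵖ) : (realifiedOf d T A hZ).cnstR Y =
    ((RealifiedDivisorMonoids.realDataWeak (divisorMonoidsOf d T A hZ)
      (isPerfFactorial_divisorMonoidsOf d T A hZ)).realSpan (divisorMonoidsOf d T A hZ).cnstGp).carrier (unop Y) := rfl

/-- Membership in the non-cuspidal part of `Φ₀^ℝ(U)` of `realifiedOf`: support inside the primes arising from the
non-cuspidal log-divisors (Def. 3.6 (iii)). [cite: MochizukiEtTh2009, Def 3.6 p.77] -/
theorem mem_realifiedOf_ncspR_iff (Y : (T.Dv)ᵒᵖ) (x : (isPerfFactorial_divisorMonoidsOf d T A hZ Y).weak.Rlf) :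
    x ∈ (realifiedOf d T A hZ).ncspR Y ↔
      supp (x : RlfFactor ((divisorMonoidsOf d T A hZ).Φ₀.obj Y)) ⊆
        RealifiedDivisorMonoids.toRSuppOfWeak (divisorMonoidsOf d T A hZ) (isPerfFactorial_divisorMonoidsOf d T A hZ) Y
          ((divisorMonoidsOf d T A hZ).ncsp₀ Y) :=
  Iff.rfl

/-- Membership in the cuspidal part of `Φ₀^ℝ(U)` of `realifiedOf`: support inside the primes arising from the cuspidal
log-divisors (Def. 3.6 (iii)). [cite: MochizukiEtTh2009, Def 3.6 p.77] -/
theorem mem_realifiedOf_cspR_iff (Y : (T.Dv)ᵒᵖ) (x : (isPerfFactorial_divisorMonoidsOf d T A hZ Y).weak.Rlf) :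
    x ∈ (realifiedOf d T A hZ).cspR Y ↔
      supp (x : RlfFactor ((divisorMonoidsOf d T A hZ).Φ₀.obj Y)) ⊆
        RealifiedDivisorMonoids.toRSuppOfWeak (divisorMonoidsOf d T A hZ) (isPerfFactorial_divisorMonoidsOf d T A hZ) Y
          ((divisorMonoidsOf d T A hZ).csp₀ Y) :=
  Iff.rfl

/-- `ℝ·Φ₀^cnst` of `realifiedOf` is an `ℝ`-subspace of `(Φ₀^rlf)^gp` (stable under the `ℝ`-action).
[cite: MochizukiEtTh2009, Def 3.6 p.76] -/
theorem realifiedOf_rsmul_mem_cnstR (Y : (T.Dv)ᵒᵖ) (s : ℝ)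
    {x : Algebra.GrothendieckGroup
      ((rlfFunctorWeak (divisorMonoidsOf d T A hZ).Φ₀ (isPerfFactorial_divisorMonoidsOf d T A hZ)).obj Y)}
    (hx : x ∈ (realifiedOf d T A hZ).cnstR Y) :
    (RealifiedDivisorMonoids.realDataWeak (divisorMonoidsOf d T A hZ)
        (isPerfFactorial_divisorMonoidsOf d T A hZ)).rsmul (unop Y) s x ∈ (realifiedOf d T A hZ).cnstR Y :=
  RealifiedDivisorMonoids.ofRlfZWeak_rsmul_mem_cnstR _ _ Y s hx

end ArithThetaTower

end Literature.AnabelianGeometry.EtaleTheta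

end
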